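import Mathlib
import Literature.NumberTheory.LFunctions.Zhang2022.Section11Leaves
import Literature.NumberTheory.LFunctions.Zhang2022.Section11AFEWindowMove
import HarnessLib

/-!
# Zhang (2022) §11: (11.1) from the TWO window mean squares alone — the `ε`-carrying Lemma 11.2
# (`Step11u024e`, kernel-proved) threaded through (11.6)

Topic `Literature/NumberTheory/LFunctions/Zhang2022` (Landau–Siegel audit tree; verdict-neutral).
Y. Zhang, *Discrete mean estimates and the Landau–Siegel zero*, arXiv:2211.02515v1 (2022)
[Zhang2022LandauSiegel], §11 "Proof of Proposition 2.6", pp. 62–66 — **an unrefereed manuscript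
under adjudication; nothing here asserts or denies its Theorems 1–2.**

Cell `siegel-zhang`, gap row G-d44-1 (the printed error `O(E₂(s,ψ))` of Lemma 11.2 / `Z22:§11.u024`
lacks the `ε = exp{−c𝓛¹⁰}` of Lemma 6.1's `E₁`; the repaired display `Section11AFE.Step11u024e`
with `O(E₂ + ε)` is PROVED in the tree, `Section11AFE.step11u024e_holds`). This file is the
CONSUMER EDGE ruled in the cell's L3 LEDGER #16 (2): the §11 chain re-run with the `ε`-carrying
Lemma 11.2, showing that the extra `ε` is harmless —

* `integral_afe_le'` — the `z`-integration step of the proof of Lemma 11.2 with an arbitrary error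
  majorant (the tree's `Section11Deductions.integral_afe_le` verbatim, bound generalised);
* `lemma112e_of_step11u024e` — Lemma 11.2 with error `C·(E₂(s,ψ) + e^{−c𝓛¹⁰})` from
  `Step11u024e` (the two integrated identities and the cancellation of `(1/500)L(s,χψ)`, as in
  `Section11Deductions.dedLem112_holds`);
* `eq116_of_lemma112e` — (11.6) from that Lemma 11.2, the `E₂` mean square `Step11u027`, Lemma 2.3,
  Prop. 2.2 (i), and — for the `ε²`-term — the total mass `ΣΣ𝔠*ω ≪ 𝓛⁹𝔓` (Lemma 8.1 + Prop. 7.1,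
  `Section11Deductions.totalMass_le`) with `𝔞 ≫ 1` (`FrakALowerBound`): `ε²·K𝓛⁹𝔓 = o(𝔞𝔓)`, the
  same absorption as `Section11Deductions.step11u020_of`;
* `eval111_of_three_leaves_e` — the edge of record: (11.1) (`Skeleton.Eval111 c′`) from
  `Step11u019 c′`, `Step11u019J2 c′`, `Section11AFE.Step11u024e` and the banked inputs;
* `eval111_of_two_windows`, `prop26_of_two_windows` — with `step11u024e_holds` plugged in:
  **(11.1), resp. Proposition 2.6 given (9.7), rest on exactly TWO printed-but-unproved displays of
  §11, the window mean squares `Step11u019`, `Step11u019J2`** (besides Lemma 2.3, Prop. 2.2 (i),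
  Lemma 8.1, Prop. 7.1, `𝔞 ≫ 1`).

Theorem-only; 0 new definitions, 0 new facts.

## References

* Y. Zhang, arXiv:2211.02515v1 (2022), §11 pp. 62–66, Lemma 11.2 and (11.6).
  [cite: Zhang2022LandauSiegel, §11 Lemma 11.2; §11 (11.6)]
-/

noncomputable section

open Complex Real ComplexConjugate MeasureTheory Set

namespace Literature.NumberTheory.LFunctions.Zhang2022.Section11LeavesEps

open Literature.NumberTheory.LFunctions.Zhang2022.Skeleton
open Literature.NumberTheory.LFunctions.Zhang2022.Typed.TypedSection11B

/-! ## §1. Lemma 11.2 with the `ε`-carrying error, from `Step11u024e` -/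

section Smooth

variable {D : ℕ} [NeZero D] (χ : DirichletCharacter ℂ D) (x : Chr D)

/-- The integration step of the proof of Lemma 11.2 with an ARBITRARY error majorant `B`: from the
pointwise approximate functional equation on `[0.5, 0.504]` (error `≤ B`) to its integral over
`[a, b] ⊆ [0.5, 0.504]` (error `≤ B(b−a)`), with `∫_a^b G(1−z)dz = ∫_{1−b}^{1−a} G` — the tree's
`Section11Deductions.integral_afe_le` verbatim with `C·E₂(s,ψ)` replaced by `B`.
[cite: Zhang2022LandauSiegel, §11 Lemma 11.2 (proof), p. 65] -/
theorem integral_afe_le' (hD : 3 ≤ D) {s : ℂ} (hs : s.re = 1 / 2) {B : ℝ} {a b : ℝ}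
    (ha : 0.5 ≤ a) (hab : a ≤ b) (hb : b ≤ 0.504)
    (h24 : ∀ z : ℝ, 0.5 ≤ z → z ≤ 0.504 →
      ‖(∑' n : ℕ, pc χ x n * (n : ℂ) ^ (-s) * (gW D (bigP D ^ z / (n : ℝ)) : ℂ)) -
          ((psiChi χ x).LFunction s -
            Zpc χ x s * ∑' n : ℕ, conj (pc χ x n) * (n : ℂ) ^ (-(1 - s)) *
              (gW D (bigP D ^ (1 - z) * (D : ℝ) * t0 D / (n : ℝ)) : ℂ))‖ ≤ B) :
    ‖(∫ z in a..b, ∑' n : ℕ, pc χ x n * (n : ℂ) ^ (-s) * (gW D (bigP D ^ z / (n : ℝ)) : ℂ)) -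
        (((b - a : ℝ) : ℂ) * (psiChi χ x).LFunction s -
          Zpc χ x s * ∫ z in (1 - b)..(1 - a), ∑' n : ℕ, conj (pc χ x n) * (n : ℂ) ^ (-(1 - s)) *
            (gW D (bigP D ^ z * (D : ℝ) * t0 D / (n : ℝ)) : ℂ))‖ ≤
      B * (b - a) := by
  obtain ⟨-, hF⟩ := Section11Deductions.hasSum_fTerm χ x hD hs (a := a) (b := b) hab
  obtain ⟨-, hG⟩ := Section11Deductions.hasSum_gTerm χ x hD hs (a := 1 - b) (b := 1 - a)
    (by linarith)
  set F : ℝ → ℂ := fun z => ∑' n : ℕ, pc χ x n * (n : ℂ) ^ (-s) * (gW D (bigP D ^ z / (n : ℝ)) : ℂ)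
    with hFdef
  set G : ℝ → ℂ := fun z => ∑' n : ℕ, conj (pc χ x n) * (n : ℂ) ^ (-(1 - s)) *
    (gW D (bigP D ^ z * (D : ℝ) * t0 D / (n : ℝ)) : ℂ) with hGdef
  have hFi : IntervalIntegrable F volume a b :=
    (hF.mono (by rw [Set.uIcc_of_le hab])).intervalIntegrable
  have hG' : ContinuousOn (fun z => G (1 - z)) (Set.uIcc a b) := by
    rw [Set.uIcc_of_le hab]
    refine hG.comp (continuous_const.sub continuous_id).continuousOn fun z hz => ?_
    exact ⟨by linarith [hz.2], by linarith [hz.1]⟩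
  have hRi : IntervalIntegrable (fun z => (psiChi χ x).LFunction s - Zpc χ x s * G (1 - z))
      volume a b :=
    intervalIntegrable_const.sub ((hG'.intervalIntegrable).const_mul _)
  have hsub : (∫ z in a..b, F z) - (((b - a : ℝ) : ℂ) * (psiChi χ x).LFunction s -
      Zpc χ x s * ∫ z in (1 - b)..(1 - a), G z) =
      ∫ z in a..b, (F z - ((psiChi χ x).LFunction s - Zpc χ x s * G (1 - z))) := by
    rw [intervalIntegral.integral_sub hFi hRi, intervalIntegral.integral_sub
      intervalIntegrable_const ((hG'.intervalIntegrable).const_mul _),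
      intervalIntegral.integral_const, intervalIntegral.integral_const_mul,
      intervalIntegral.integral_comp_sub_left (fun z => G z) 1, Complex.real_smul]
  rw [hsub]
  have hbound : ∀ z ∈ Set.uIoc a b,
      ‖F z - ((psiChi χ x).LFunction s - Zpc χ x s * G (1 - z))‖ ≤ B := by
    intro z hz
    rw [Set.uIoc_of_le hab] at hz
    exact h24 z (by linarith [hz.1]) (by linarith [hz.2])
  have := intervalIntegral.norm_integral_le_of_norm_le_const hbound
  rwa [abs_of_nonneg (by linarith : 0 ≤ b - a)] at this

end Smooth

/-- **Lemma 11.2 with the error of Lemma 6.1's shape**, from the kernel-proved smoothed approximate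
functional equation `Section11AFE.Step11u024e`: for `ψ ∈ Ψ`, `σ = 1/2`, `|t − 2πt₀| < 𝓛₁` (under
(A)), `J̃₁(s,ψ) = Z(s,χψ)J̃₂(1−s,ψ̄) + O(E₂(s,ψ) + e^{−c𝓛¹⁰})` — the two integrated identities
(`∫_{0.5}^{0.502}`, `∫_{0.502}^{0.504}`, `z ↦ 1 − z`), `J̃₁ = −500∫ + 500∫`, `J̃₂(1−s,ψ̄) = −500∫ + 500∫`
(`Section11Deductions.Jtilde1_eq_integrals`, `Jtilde2Bar_eq_integrals`) and the cancellation of the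
two `(1/500)L(s,χψ)`, exactly as in `Section11Deductions.dedLem112_holds`.
[cite: Zhang2022LandauSiegel, §11 Lemma 11.2 (proof), p. 65, tex L3329–L3346] -/
theorem lemma112e_of_step11u024e (h24 : Section11AFE.Step11u024e) :
    ∃ c : ℝ, 0 < c ∧ ∃ C : ℝ, ForAllLarge fun D _ χ => AssumptionA D χ → ∀ x : Chr D, ∀ s : ℂ,
      s.re = 1 / 2 → |s.im - 2 * π * t0 D| < ell1 D →
        ‖Jtilde1 χ x s - Zpc χ x s * Jtilde2Bar χ x (1 - s)‖ ≤
          C * (E2main χ x s + Real.exp (-c * ell D ^ 10)) := by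
  obtain ⟨c, hc, C, D₀, h⟩ := h24
  refine ⟨c, hc, 2 * C, max D₀ 3, fun D _ χ hD hq hp hA x s hs ht => ?_⟩
  have hD3 : 3 ≤ D := le_trans (le_max_right _ _) hD
  have h24' := h D χ (le_trans (le_max_left _ _) hD) hq hp hA x s hs ht
  set B : ℝ := C * (E2main χ x s + Real.exp (-c * ell D ^ 10)) with hB
  have k5 := integral_afe_le' χ x hD3 hs (B := B) (a := 0.5) (b := 0.502) (by norm_num)
    (by norm_num) (by norm_num) h24'
  have k6 := integral_afe_le' χ x hD3 hs (B := B) (a := 0.502) (b := 0.504) (by norm_num)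
    (by norm_num) (by norm_num) h24'
  have e1 : ((0.502 - 0.5 : ℝ) : ℂ) = (1 / 500 : ℂ) := by norm_num
  have e2 : (1 : ℝ) - 0.502 = 0.498 := by norm_num
  have e3 : (1 : ℝ) - 0.5 = 0.5 := by norm_num
  have e4 : (0.502 - 0.5 : ℝ) = 1 / 500 := by norm_num
  rw [e1, e2, e3, e4] at k5
  have e1' : ((0.504 - 0.502 : ℝ) : ℂ) = (1 / 500 : ℂ) := by norm_num
  have e2' : (1 : ℝ) - 0.504 = 0.496 := by norm_num
  have e3' : (1 : ℝ) - 0.502 = 0.498 := by norm_num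
  have e4' : (0.504 - 0.502 : ℝ) = 1 / 500 := by norm_num
  rw [e1', e2', e3', e4'] at k6
  rw [Section11Deductions.Jtilde1_eq_integrals χ x hD3 hs,
    Section11Deductions.Jtilde2Bar_eq_integrals χ x hD3 hs]
  set A₁ := ∫ z in (0.5 : ℝ)..0.502, ∑' n : ℕ, pc χ x n * (n : ℂ) ^ (-s) *
    (gW D (bigP D ^ z / (n : ℝ)) : ℂ)
  set A₂ := ∫ z in (0.502 : ℝ)..0.504, ∑' n : ℕ, pc χ x n * (n : ℂ) ^ (-s) *
    (gW D (bigP D ^ z / (n : ℝ)) : ℂ)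
  set B₁ := ∫ z in (0.496 : ℝ)..0.498, ∑' n : ℕ, conj (pc χ x n) * (n : ℂ) ^ (-(1 - s)) *
    (gW D (bigP D ^ z * (D : ℝ) * t0 D / (n : ℝ)) : ℂ)
  set B₂ := ∫ z in (0.498 : ℝ)..0.5, ∑' n : ℕ, conj (pc χ x n) * (n : ℂ) ^ (-(1 - s)) *
    (gW D (bigP D ^ z * (D : ℝ) * t0 D / (n : ℝ)) : ℂ)
  set L := (psiChi χ x).LFunction s
  set Z := Zpc χ x s
  have hB0 : 0 ≤ B := le_trans (norm_nonneg _) (h24' 0.5 (by norm_num) (by norm_num))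
  have key : -500 * A₁ + 500 * A₂ - Z * (-500 * B₁ + 500 * B₂) =
      -500 * (A₁ - ((1 / 500 : ℂ) * L - Z * B₂)) + 500 * (A₂ - ((1 / 500 : ℂ) * L - Z * B₁)) := by
    ring
  rw [key]
  calc ‖-500 * (A₁ - ((1 / 500 : ℂ) * L - Z * B₂)) + 500 * (A₂ - ((1 / 500 : ℂ) * L - Z * B₁))‖
      ≤ ‖-500 * (A₁ - ((1 / 500 : ℂ) * L - Z * B₂))‖ + ‖500 * (A₂ - ((1 / 500 : ℂ) * L - Z * B₁))‖ :=
        norm_add_le _ _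
    _ = 500 * ‖A₁ - ((1 / 500 : ℂ) * L - Z * B₂)‖ + 500 * ‖A₂ - ((1 / 500 : ℂ) * L - Z * B₁)‖ := by
        rw [norm_mul, norm_mul, norm_neg]; norm_num
    _ ≤ 500 * (B * (1 / 500)) + 500 * (B * (1 / 500)) := by gcongr
    _ = 2 * C * (E2main χ x s + Real.exp (-c * ell D ^ 10)) := by rw [hB]; ring

/-! ## §2. (11.6) from the `ε`-carrying Lemma 11.2 -/

/-- `e^{−y} ≤ 1/y` for `y > 0`. [folklore] -/
private theorem exp_neg_le_inv {y : ℝ} (hy : 0 < y) : Real.exp (-y) ≤ y⁻¹ := by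
  rw [Real.exp_neg]
  exact inv_anti₀ hy (by linarith [Real.add_one_le_exp y])

variable (c' : ℝ)

/-- **(11.6) (`Eq116 c′`) from the `ε`-carrying Lemma 11.2** ("By Lemma 11.2, the proof of (11.6)
is reduced to showing that `ΣΣ𝔠*E₂²ω = o(𝔞𝔓)`", p. 65, with the repaired error): at each index
`ρ` lies on the critical line (Prop. 2.2 (i), so Lemma 11.2 applies at `s = ρ` and `ω(ρ) > 0`) and
`𝔠* ≥ 0` (Lemma 2.3); `|J̃₁ − ZJ̃₂|² ≤ 2C²E₂² + 2C²e^{−2c𝓛¹⁰}`; the first term has mean square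
`o(𝔞𝔓)` by `Step11u027`, the second is absorbed by the total mass `ΣΣ𝔠*ω ≪ 𝓛⁹𝔓` (Lemma 8.1 +
Prop. 7.1, `Section11Deductions.totalMass_le`) and `𝔞 ≫ 1` (`FrakALowerBound`), since
`𝓛⁹e^{−c𝓛¹⁰} → 0` — the DedEq116 budget `o(𝔞𝔓)` absorbs the `ε` of gap row G-d44-1.
[cite: Zhang2022LandauSiegel, §11 (11.6) p. 65, tex L3348–L3351] -/
theorem eq116_of_lemma112e (h23 : Lemma23 c') (h22 : Prop22i) (h81 : Lemma81 c')
    (h71 : Prop71 c') (ha : FrakALowerBound)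
    (h112 : ∃ c : ℝ, 0 < c ∧ ∃ C : ℝ, ForAllLarge fun D _ χ => AssumptionA D χ → ∀ x : Chr D,
      ∀ s : ℂ, s.re = 1 / 2 → |s.im - 2 * π * t0 D| < ell1 D →
        ‖Jtilde1 χ x s - Zpc χ x s * Jtilde2Bar χ x (1 - s)‖ ≤
          C * (E2main χ x s + Real.exp (-c * ell D ^ 10)))
    (h27 : Step11u027 c') : Eq116 c' := by
  intro ε hε
  obtain ⟨K, hK, hW⟩ := Section11Deductions.totalMass_le c' h23 h22 h81 h71
  obtain ⟨c, hc, C, h112⟩ := h112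
  obtain ⟨a₀, ha₀, ha⟩ := ha
  set ε₁ : ℝ := ε / (4 * (C ^ 2 + 1)) with hε₁
  have hε₁0 : 0 < ε₁ := by positivity
  obtain ⟨D₀, h⟩ := ((((h22.and h23).and hW).and h112).and (h27 ε₁ hε₁0)).and ha
  -- the threshold beyond which `2C²K𝓛⁹e^{−c𝓛¹⁰} ≤ (ε/2)a₀`
  set δ : ℝ := ε * a₀ / (4 * (C ^ 2 * K + 1)) with hδ
  have hδ0 : 0 < δ := by positivity
  set D₁ : ℕ := ⌈Real.exp (1 / (c * δ))⌉₊ with hD₁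
  refine ⟨max (max D₀ D₁) 9, fun D _ χ hD hq hp hA => ?_⟩
  have hD9 : 9 ≤ D := le_trans (le_max_right _ _) hD
  have hD3 : 3 ≤ D := le_trans (by norm_num) hD9
  have hℓ : 2 ≤ ell D := Section6TailBounds.two_le_ell hD9
  have hDD₁ : D₁ ≤ D := le_trans (le_trans (le_max_right _ _) (le_max_left _ _)) hD
  obtain ⟨⟨⟨⟨⟨h22', h23'⟩, hW'⟩, h112'⟩, h27'⟩, ha'⟩ :=
    h D χ (le_trans (le_trans (le_max_left _ _) (le_max_left _ _)) hD) hq hp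
  have mem : ∀ i ∈ idx χ, i.1 ∈ PsiOne χ ∧ i.2 ∈ zeroSet D i.1 :=
    fun i hi => Section11Deductions.mem_idx χ hi
  have hre : ∀ i ∈ idx χ, i.2.re = 1 / 2 := fun i hi =>
    h22' i.1 (mem i hi).1 i.2 (mem_prodZeroSetOmega_of_mem_zeroSet χ (mem i hi).2)
  have him : ∀ i ∈ idx χ, |i.2.im - 2 * π * t0 D| < ell1 D := fun i hi => by
    obtain ⟨-, him', -⟩ := (mem i hi).2
    exact him'
  have hc0 : ∀ i ∈ idx χ, 0 ≤ (cstar c' D i.1 i.2).re := fun i hi =>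
    (h23' i.1 (mem i hi).1 i.2 (mem i hi).2).2
  have hω : ∀ i ∈ idx χ, 0 < (omegaW D i.2).re := fun i hi => (omegaW_re_pos hD3 (hre i hi)).1
  -- the size of `𝓛⁹e^{−c𝓛¹⁰}`
  have hℓpos : 0 < ell D := by linarith
  have hsmall : ell D ^ 9 * Real.exp (-c * ell D ^ 10) ≤ δ := by
    have h1 : Real.exp (-c * ell D ^ 10) ≤ (c * ell D ^ 10)⁻¹ := by
      rw [neg_mul]; exact exp_neg_le_inv (by positivity)
    have h2 : ell D ^ 9 * (c * ell D ^ 10)⁻¹ = (c * ell D)⁻¹ := by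
      field_simp
    have h3 : 1 / (c * δ) ≤ ell D := by
      have hexp : Real.exp (1 / (c * δ)) ≤ D :=
        le_trans (Nat.le_ceil _) (by exact_mod_cast hDD₁)
      have := Real.log_le_log (Real.exp_pos _) hexp
      rwa [Real.log_exp, ← ell] at this
    have h4 : (c * ell D)⁻¹ ≤ δ := by
      rw [inv_le_comm₀ (by positivity) hδ0]
      calc δ⁻¹ = c * (1 / (c * δ)) := by field_simp
        _ ≤ c * ell D := mul_le_mul_of_nonneg_left h3 hc.le
    calc ell D ^ 9 * Real.exp (-c * ell D ^ 10) ≤ ell D ^ 9 * (c * ell D ^ 10)⁻¹ :=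
          mul_le_mul_of_nonneg_left h1 (by positivity)
      _ = (c * ell D)⁻¹ := h2
      _ ≤ δ := h4
  -- termwise
  set E : ℝ := C * Real.exp (-c * ell D ^ 10) with hE
  have hexp1 : Real.exp (-c * ell D ^ 10) ≤ 1 := by
    rw [Real.exp_le_one_iff]; rw [neg_mul]; exact neg_nonpos.mpr (by positivity)
  have hE2 : E ^ 2 ≤ C ^ 2 * Real.exp (-c * ell D ^ 10) := by
    rw [hE, mul_pow, sq (Real.exp _)]
    exact mul_le_mul_of_nonneg_left
      (mul_le_of_le_one_right (Real.exp_pos _).le hexp1) (sq_nonneg C)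
  have hterm : ∀ i ∈ idx χ,
      (cstar c' D i.1 i.2).re * ‖Jtilde1 χ i.1 i.2 - Zpc χ i.1 i.2 * Jtilde2Bar χ i.1 (1 - i.2)‖ ^ 2 *
          (omegaW D i.2).re ≤
        2 * C ^ 2 * ((cstar c' D i.1 i.2).re * E2main χ i.1 i.2 ^ 2 * (omegaW D i.2).re) +
          2 * E ^ 2 * ((cstar c' D i.1 i.2).re * (omegaW D i.2).re) := by
    intro i hi
    have h1 : ‖Jtilde1 χ i.1 i.2 - Zpc χ i.1 i.2 * Jtilde2Bar χ i.1 (1 - i.2)‖ ≤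
        C * E2main χ i.1 i.2 + E := by
      have := h112' hA i.1 i.2 (hre i hi) (him i hi)
      rw [hE]; linarith
    have h0 : 0 ≤ ‖Jtilde1 χ i.1 i.2 - Zpc χ i.1 i.2 * Jtilde2Bar χ i.1 (1 - i.2)‖ := norm_nonneg _
    have h2 : ‖Jtilde1 χ i.1 i.2 - Zpc χ i.1 i.2 * Jtilde2Bar χ i.1 (1 - i.2)‖ ^ 2 ≤
        2 * C ^ 2 * E2main χ i.1 i.2 ^ 2 + 2 * E ^ 2 := by
      nlinarith [sq_nonneg (C * E2main χ i.1 i.2 - E)]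
    have h3 := mul_le_mul_of_nonneg_right (mul_le_mul_of_nonneg_left h2 (hc0 i hi)) (hω i hi).le
    calc _ ≤ (cstar c' D i.1 i.2).re * (2 * C ^ 2 * E2main χ i.1 i.2 ^ 2 + 2 * E ^ 2) *
          (omegaW D i.2).re := h3
      _ = _ := by ring
  have hX : 0 ≤ frakA χ * frakP D := mul_nonneg (frakA_nonneg χ) (frakP_nonneg D)
  have hP : 0 ≤ frakP D := frakP_nonneg D
  have hWD := hW' hA
  have h27D := h27' hA
  have haD : a₀ ≤ frakA χ := ha' hA
  have hW0 : 0 ≤ ∑ i ∈ idx χ, (cstar c' D i.1 i.2).re * (omegaW D i.2).re :=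
    Finset.sum_nonneg fun i hi => mul_nonneg (hc0 i hi) (hω i hi).le
  -- the absorbed term: `2E²·W ≤ 2C²e^{−c𝓛¹⁰}K𝓛⁹𝔓 ≤ (ε/2)a₀𝔓 ≤ (ε/2)𝔞𝔓`
  have habs : 2 * E ^ 2 * ∑ i ∈ idx χ, (cstar c' D i.1 i.2).re * (omegaW D i.2).re ≤
      ε / 2 * frakA χ * frakP D := by
    calc 2 * E ^ 2 * ∑ i ∈ idx χ, (cstar c' D i.1 i.2).re * (omegaW D i.2).re
        ≤ 2 * (C ^ 2 * Real.exp (-c * ell D ^ 10)) * (K * ell D ^ 9 * frakP D) :=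
          mul_le_mul (mul_le_mul_of_nonneg_left hE2 (by norm_num)) hWD hW0 (by positivity)
      _ = 2 * C ^ 2 * K * (ell D ^ 9 * Real.exp (-c * ell D ^ 10)) * frakP D := by ring
      _ ≤ 2 * C ^ 2 * K * δ * frakP D := by gcongr
      _ ≤ ε / 2 * a₀ * frakP D := by
          apply mul_le_mul_of_nonneg_right _ hP
          rw [hδ]
          have hCK : 0 ≤ C ^ 2 * K := by positivity
          rw [show 2 * C ^ 2 * K * (ε * a₀ / (4 * (C ^ 2 * K + 1))) =
              (C ^ 2 * K / (C ^ 2 * K + 1)) * (ε / 2 * a₀) by field_simp; ring]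
          have : C ^ 2 * K / (C ^ 2 * K + 1) ≤ 1 := by
            rw [div_le_one (by positivity)]; linarith
          exact le_trans (mul_le_mul_of_nonneg_right this (by positivity)) (by rw [one_mul])
      _ ≤ ε / 2 * frakA χ * frakP D := by gcongr
  -- the `E₂²`-term: `2C²·ε₁𝔞𝔓 ≤ (ε/2)𝔞𝔓`
  have hCε : 2 * C ^ 2 * ε₁ ≤ ε / 2 := by
    rw [hε₁]
    rw [show 2 * C ^ 2 * (ε / (4 * (C ^ 2 + 1))) = (C ^ 2 / (C ^ 2 + 1)) * (ε / 2) by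
      field_simp; ring]
    have : C ^ 2 / (C ^ 2 + 1) ≤ 1 := by
      rw [div_le_one (by positivity)]; linarith
    exact le_trans (mul_le_mul_of_nonneg_right this (by positivity)) (by rw [one_mul])
  calc ∑ i ∈ idx χ, (cstar c' D i.1 i.2).re *
          ‖Jtilde1 χ i.1 i.2 - Zpc χ i.1 i.2 * Jtilde2Bar χ i.1 (1 - i.2)‖ ^ 2 * (omegaW D i.2).re
      ≤ ∑ i ∈ idx χ, (2 * C ^ 2 * ((cstar c' D i.1 i.2).re * E2main χ i.1 i.2 ^ 2 *
            (omegaW D i.2).re) +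
          2 * E ^ 2 * ((cstar c' D i.1 i.2).re * (omegaW D i.2).re)) := Finset.sum_le_sum hterm
    _ = 2 * C ^ 2 * (∑ i ∈ idx χ, (cstar c' D i.1 i.2).re * E2main χ i.1 i.2 ^ 2 *
            (omegaW D i.2).re) +
          2 * E ^ 2 * ∑ i ∈ idx χ, (cstar c' D i.1 i.2).re * (omegaW D i.2).re := by
        rw [Finset.sum_add_distrib, Finset.mul_sum, Finset.mul_sum]
    _ ≤ 2 * C ^ 2 * (ε₁ * frakA χ * frakP D) + ε / 2 * frakA χ * frakP D :=
        add_le_add (mul_le_mul_of_nonneg_left h27D (by positivity)) habs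
    _ = (2 * C ^ 2 * ε₁) * (frakA χ * frakP D) + ε / 2 * frakA χ * frakP D := by ring
    _ ≤ (ε / 2) * (frakA χ * frakP D) + ε / 2 * frakA χ * frakP D := by
        gcongr
    _ = ε * frakA χ * frakP D := by ring

/-! ## §3. (11.1) and Proposition 2.6 from the window mean squares -/

/-- **The consumer edge of gap row G-d44-1** (L3 LEDGER #16 (2)): (11.1) (`Skeleton.Eval111 c′`)
from the two window mean squares `Step11u019 c′`, `Step11u019J2 c′` ("by (11.3), (8.25) and
(8.26)"; "Similarly"), the REPAIRED smoothed approximate functional equation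
`Section11AFE.Step11u024e` (error `O(E₂ + e^{−c𝓛¹⁰})`), and the banked inputs Lemma 2.3,
Prop. 2.2 (i), Lemma 8.1, Prop. 7.1, `𝔞 ≫ 1` — composing `dedProp26_holds` with
`Section11Deductions.dedStep11u020_holds` (+ `eq115_holds`), `step11u021_of_window`,
`eq116_of_lemma112e`, `lemma112e_of_step11u024e` and `Section11Leaves.step11u027_of_lemma81_prop71`.
The extra `ε` of Lemma 6.1's shape is absorbed by the `o(𝔞𝔓)` budget of (11.6).
[cite: Zhang2022LandauSiegel, §11 pp. 62–66] -/
theorem eval111_of_three_leaves_e (h23 : Lemma23 c') (h22 : Prop22i) (h81 : Lemma81 c')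
    (h71 : Prop71 c') (ha : FrakALowerBound) (h19 : Step11u019 c') (h19J2 : Step11u019J2 c')
    (h24e : Section11AFE.Step11u024e) : Eval111 c' :=
  dedProp26_holds c' h23 h22 psiChiPrimitive_holds
    (Section11Deductions.dedStep11u020_holds c' h23 h22 h81 h71 ha eq115_holds h19)
    (step11u021_of_window c' h23 h22 h81 h71 ha h19J2)
    (eq116_of_lemma112e c' h23 h22 h81 h71 ha (lemma112e_of_step11u024e h24e)
      (Section11Leaves.step11u027_of_lemma81_prop71 c' h23 h22 h81 h71 ha))

/-- **(11.1) (`Skeleton.Eval111 c′`) from the TWO window mean squares alone**: with the repaired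
Lemma 11.2 display kernel-proved (`Section11AFE.step11u024e_holds`), (11.1) rests — besides
Lemma 2.3, Prop. 2.2 (i), Lemma 8.1, Prop. 7.1 and `𝔞 ≫ 1` — on exactly the two printed-but-unproved
window mean squares `Step11u019 c′` and `Step11u019J2 c′` of §11 ("by (11.3), (8.25) and (8.26)";
the displays (8.25)/(8.26) do not exist in v1). [cite: Zhang2022LandauSiegel, §11 pp. 62–66] -/
theorem eval111_of_two_windows (h23 : Lemma23 c') (h22 : Prop22i) (h81 : Lemma81 c')
    (h71 : Prop71 c') (ha : FrakALowerBound) (h19 : Step11u019 c') (h19J2 : Step11u019J2 c') :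
    Eval111 c' :=
  eval111_of_three_leaves_e c' h23 h22 h81 h71 ha h19 h19J2 Section11AFE.step11u024e_holds

/-- **Proposition 2.6 from the two window mean squares and (9.7)** (`Skeleton.Eval97 c′`), via the
banked Cauchy step `Skeleton.prop26_of_evals`. [cite: Zhang2022LandauSiegel, §11 p. 62] -/
theorem prop26_of_two_windows (h23 : Lemma23 c') (h22 : Prop22i) (h81 : Lemma81 c')
    (h71 : Prop71 c') (ha : FrakALowerBound) (h19 : Step11u019 c') (h19J2 : Step11u019J2 c')
    (h97 : Eval97 c') : Prop26 c' :=
  prop26_of_evals h22 h23 psiChiPrimitive_holds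
    (eval111_of_two_windows c' h23 h22 h81 h71 ha h19 h19J2) h97 ha

end Literature.NumberTheory.LFunctions.Zhang2022.Section11LeavesEps
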